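import Summits.CriticalPhenomena.PercolationContinuityZ3.Theorems.TransplantHeisenbergZConnected
import Literature.Probability.Percolation.SeedLemma
import Literature.Probability.Percolation.CoveringTameFibres
import Literature.Barriers.CriticalPhenomena.BLPSCriticalReduction
import HarnessLib

/-!
# Point symmetries, skeleton map and amenability of `Cay(H₃(ℤ) × ℤ)` (data for its planar skeleton)

builds on p205010 (kernel theorem, internal audit signed; external expert review pending) — nothing in this file uses p205010.
Lane `prim-bschramm`, seat `prim-bschramm-p4` (gen 2; class map), helper file (`--supports stmt-CriticalPhenomena-4575`);
consumed by `Transplant/HeisenbergZPlanarSkeleton.lean` (the `PlanarSkeleton` instance of `H₃(ℤ) × ℤ` and its conditional closure).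

* `hzGens`, `hz_adj_iff` — edges of `heisenbergZGraph` (stmt/p3, `TransplantHeisenbergZ.lean`) are right multiplications by the six
  generators; `isoOfInvolutiveAut` — a generator-permuting involutive multiplicative map is a graph automorphism;
* `hzSwap (a,b,c,t) = (b,a,ab−c,t)` (`A ↔ B`), `hzFlip (a,b,c,t) = (−a,b,−c,t)` (`A ↦ A⁻¹`), both fixing `T`: involutive graph
  automorphisms `hzSwapIso`, `hzFlipIso` fixing `1` — the Heisenberg factor's `D₄` (p4 gen 1, p207877, for `H₃`) extended by the identity on `ℤ`;
* `hzAb (a,b,c,t) = (a,b)` — additive (`hzAb_hzMul`), sup-norm 1-Lipschitz along edges (`abs_hzAb_sub_le_one`); `hzPointIso g` realises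
  every `g : HOct 2` with `hzAb ∘ hzPointIso g = sp g ∘ hzAb` (`hzAb_hzPointIso`);
* `walk_coord_bounds`, `ballVolume_heisenbergZ_le` (`|B(x,n)| ≤ (2n+1)⁵`), `heisenbergZ_not_hasExponentialGrowth`,
  **`isGraphAmenable_heisenbergZ`** — so the infinite cluster is a.s. unique at every `p` (tree Burton–Keane) and Hutchcroft 2016 does not apply.
[cite: CheegerKleinerNaor2011, §1.1] [cite: LyonsPeres2016, §6.1 (p. 279); Thm. 7.6] [cite: Hutchcroft2016, Thm. 1]
-/

noncomputable section

namespace Summit.CriticalPhenomena.PercolationContinuityZ3.Theorems.Transplant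

open MeasureTheory Filter Literature.Probability.Percolation Literature.Probability.LatticeModels
open Literature.Probability.Percolation.GM
open Literature.Barriers.CriticalPhenomena (IsQuasiTransitive IsGraphAmenable HasExponentialGrowth graphBall ballVolume
  hasExponentialGrowth_of_not_isGraphAmenable eventually_pow_lt_const_pow)
open HeisenbergZ

/-! ## Edges of `Cay(H₃(ℤ) × ℤ)` are right multiplications by the six generators -/

/-- The six generators `A^{±1}, B^{±1}, T^{±1}` as a finite set. [folklore] -/
def hzGens : Finset HZ := {gA, gB, gT, gAinv, gBinv, gTinv}

/-- Membership in `hzGens`, unfolded. [folklore] -/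
theorem mem_hzGens_iff (s : HZ) : s ∈ hzGens ↔ s = gA ∨ s = gB ∨ s = gT ∨ s = gAinv ∨ s = gBinv ∨ s = gTinv := by
  simp only [hzGens, Finset.mem_insert, Finset.mem_singleton]

/-- Adjacency in `Cay(H₃(ℤ) × ℤ)` is right multiplication by a generator. [folklore] -/
theorem hz_adj_iff (x y : HZ) : heisenbergZGraph.Adj x y ↔ ∃ s ∈ hzGens, y = hzMul x s := by
  constructor
  · intro h
    have hy := neighborSet_subset x ((SimpleGraph.mem_neighborSet _ _ _).2 h)
    simp only [Set.mem_insert_iff, Set.mem_singleton_iff] at hy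
    simp only [mem_hzGens_iff]
    rcases hy with h | h | h | h | h | h
    · exact ⟨gA, Or.inl rfl, h⟩
    · exact ⟨gB, Or.inr (Or.inl rfl), h⟩
    · exact ⟨gT, Or.inr (Or.inr (Or.inl rfl)), h⟩
    · exact ⟨gAinv, Or.inr (Or.inr (Or.inr (Or.inl rfl))), h⟩
    · exact ⟨gBinv, Or.inr (Or.inr (Or.inr (Or.inr (Or.inl rfl)))), h⟩
    · exact ⟨gTinv, Or.inr (Or.inr (Or.inr (Or.inr (Or.inr rfl)))), h⟩
  · rintro ⟨s, hs, rfl⟩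
    exact adj_mul_gen x ((mem_hzGens_iff s).1 hs)

/-- **A generator-permuting involutive endomorphism of the group is a graph automorphism of the Cayley graph.**
[cite: BenjaminiSchramm1996, §2 (Cayley graphs)] -/
def isoOfInvolutiveAut (σ : HZ → HZ) (hσσ : ∀ x, σ (σ x) = x) (hmul : ∀ x y, σ (hzMul x y) = hzMul (σ x) (σ y))
    (hgen : ∀ s ∈ hzGens, σ s ∈ hzGens) : heisenbergZGraph ≃g heisenbergZGraph where
  toEquiv := ⟨σ, σ, hσσ, hσσ⟩
  map_rel_iff' := by
    have key : ∀ a b : HZ, heisenbergZGraph.Adj a b → heisenbergZGraph.Adj (σ a) (σ b) := by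
      intro a b h
      obtain ⟨s, hs, rfl⟩ := (hz_adj_iff a b).1 h
      rw [hmul]
      exact (hz_adj_iff _ _).2 ⟨σ s, hgen s hs, rfl⟩
    intro a b
    constructor
    · intro h
      have := key _ _ h
      simpa only [Equiv.coe_fn_mk, hσσ] using this
    · exact key a b

/-! ## The point symmetries `A ↔ B` and `A ↦ A⁻¹` -/

/-- The swap automorphism `A ↔ B, T ↦ T` in coordinates: `(a,b,c,t) ↦ (b, a, ab − c, t)`. [cite: CheegerKleinerNaor2011, §1.1] -/
def hzSwap (x : HZ) : HZ := ![x 1, x 0, x 0 * x 1 - x 2, x 3]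

/-- The flip automorphism `A ↦ A⁻¹, B ↦ B, T ↦ T` in coordinates: `(a,b,c,t) ↦ (−a, b, −c, t)`. [cite: CheegerKleinerNaor2011, §1.1] -/
def hzFlip (x : HZ) : HZ := ![-x 0, x 1, -x 2, x 3]

/-- `hzSwap` is an involution. [folklore] -/
@[simp] theorem hzSwap_hzSwap (x : HZ) : hzSwap (hzSwap x) = x := by
  ext i
  fin_cases i <;> simp [hzSwap]
  ring

/-- `hzFlip` is an involution. [folklore] -/
@[simp] theorem hzFlip_hzFlip (x : HZ) : hzFlip (hzFlip x) = x := by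
  ext i; fin_cases i <;> simp [hzFlip]

/-- `hzSwap` is multiplicative. [folklore] -/
theorem hzSwap_hzMul (x y : HZ) : hzSwap (hzMul x y) = hzMul (hzSwap x) (hzSwap y) := by
  ext i
  fin_cases i <;> simp [hzSwap, hzMul]
  ring

/-- `hzFlip` is multiplicative. [folklore] -/
theorem hzFlip_hzMul (x y : HZ) : hzFlip (hzMul x y) = hzMul (hzFlip x) (hzFlip y) := by
  ext i; fin_cases i <;> simp [hzFlip, hzMul] <;> ring

/-- `hzSwap` permutes the generators (`A ↔ B`, `A⁻¹ ↔ B⁻¹`, `T^{±1}` fixed). [folklore] -/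
theorem hzSwap_gen (s : HZ) (hs : s ∈ hzGens) : hzSwap s ∈ hzGens := by
  rw [mem_hzGens_iff] at hs ⊢
  rcases hs with rfl | rfl | rfl | rfl | rfl | rfl
  · refine Or.inr (Or.inl ?_); ext i; fin_cases i <;> simp [hzSwap, gA, gB]
  · refine Or.inl ?_; ext i; fin_cases i <;> simp [hzSwap, gA, gB]
  · refine Or.inr (Or.inr (Or.inl ?_)); ext i; fin_cases i <;> simp [hzSwap, gT]
  · refine Or.inr (Or.inr (Or.inr (Or.inr (Or.inl ?_)))); ext i; fin_cases i <;> simp [hzSwap, gAinv, gBinv]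
  · refine Or.inr (Or.inr (Or.inr (Or.inl ?_))); ext i; fin_cases i <;> simp [hzSwap, gAinv, gBinv]
  · refine Or.inr (Or.inr (Or.inr (Or.inr (Or.inr ?_)))); ext i; fin_cases i <;> simp [hzSwap, gTinv]

/-- `hzFlip` permutes the generators (`A ↔ A⁻¹`, the rest fixed). [folklore] -/
theorem hzFlip_gen (s : HZ) (hs : s ∈ hzGens) : hzFlip s ∈ hzGens := by
  rw [mem_hzGens_iff] at hs ⊢
  rcases hs with rfl | rfl | rfl | rfl | rfl | rfl
  · refine Or.inr (Or.inr (Or.inr (Or.inl ?_))); ext i; fin_cases i <;> simp [hzFlip, gA, gAinv]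
  · refine Or.inr (Or.inl ?_); ext i; fin_cases i <;> simp [hzFlip, gB]
  · refine Or.inr (Or.inr (Or.inl ?_)); ext i; fin_cases i <;> simp [hzFlip, gT]
  · refine Or.inl ?_; ext i; fin_cases i <;> simp [hzFlip, gA, gAinv]
  · refine Or.inr (Or.inr (Or.inr (Or.inr (Or.inl ?_)))); ext i; fin_cases i <;> simp [hzFlip, gBinv]
  · refine Or.inr (Or.inr (Or.inr (Or.inr (Or.inr ?_)))); ext i; fin_cases i <;> simp [hzFlip, gTinv]

/-- **`A ↔ B` as a graph automorphism of `Cay(H₃(ℤ) × ℤ)` fixing `1`.** [cite: CheegerKleinerNaor2011, §1.1] -/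
def hzSwapIso : heisenbergZGraph ≃g heisenbergZGraph := isoOfInvolutiveAut hzSwap hzSwap_hzSwap hzSwap_hzMul hzSwap_gen

/-- **`A ↦ A⁻¹` as a graph automorphism of `Cay(H₃(ℤ) × ℤ)` fixing `1`.** [cite: CheegerKleinerNaor2011, §1.1] -/
def hzFlipIso : heisenbergZGraph ≃g heisenbergZGraph := isoOfInvolutiveAut hzFlip hzFlip_hzFlip hzFlip_hzMul hzFlip_gen

/-- `hzSwapIso` acts by `hzSwap`. [folklore] -/
@[simp] theorem hzSwapIso_apply (x : HZ) : hzSwapIso x = hzSwap x := rfl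

/-- `hzFlipIso` acts by `hzFlip`. [folklore] -/
@[simp] theorem hzFlipIso_apply (x : HZ) : hzFlipIso x = hzFlip x := rfl

/-- `hzSwap 1 = 1`. [folklore] -/
@[simp] theorem hzSwap_zero : hzSwap 0 = 0 := by
  ext i; fin_cases i <;> simp [hzSwap]

/-- `hzFlip 1 = 1`. [folklore] -/
@[simp] theorem hzFlip_zero : hzFlip 0 = 0 := by
  ext i; fin_cases i <;> simp [hzFlip]

/-! ## The skeleton map `(a,b,c,t) ↦ (a,b)` -/

/-- The skeleton map `hzAb (a,b,c,t) = (a,b) ∈ ℤ²`. [cite: KozmaNitzan2024, §4 p. 15 (the role of the coordinates)] -/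
def hzAb (x : HZ) : Site 2 := ![x 0, x 1]

/-- Coordinate `0` of `hzAb`. [folklore] -/
@[simp] theorem hzAb_apply_zero (x : HZ) : hzAb x 0 = x 0 := rfl

/-- Coordinate `1` of `hzAb`. [folklore] -/
@[simp] theorem hzAb_apply_one (x : HZ) : hzAb x 1 = x 1 := rfl

/-- `hzAb 1 = 0`. [folklore] -/
@[simp] theorem hzAb_zero : hzAb 0 = 0 := by
  ext i; fin_cases i <;> rfl

/-- `hzAb` is a homomorphism to `ℤ²`. [folklore] -/
theorem hzAb_hzMul (x y : HZ) : hzAb (hzMul x y) = hzAb x + hzAb y := by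
  ext i; fin_cases i <;> simp [hzAb, hzMul]

/-- **Lipschitz**: along an edge the skeleton coordinates move by at most one each. [folklore] -/
theorem abs_hzAb_sub_le_one {x y : HZ} (h : heisenbergZGraph.Adj x y) (i : Fin 2) : |hzAb x i - hzAb y i| ≤ 1 := by
  obtain ⟨s, hs, rfl⟩ := (hz_adj_iff x y).1 h
  rw [hzAb_hzMul]
  rw [mem_hzGens_iff] at hs
  rcases hs with rfl | rfl | rfl | rfl | rfl | rfl <;> fin_cases i <;>
    simp [hzAb, gA, gB, gT, gAinv, gBinv, gTinv]

/-! ## The lifted point group `D₄ = HOct 2` -/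

/-- The identity isomorphism applied to a vertex. [folklore] -/
@[simp] theorem hz_iso_refl_apply (w : HZ) : (SimpleGraph.Iso.refl (G := heisenbergZGraph)) w = w := rfl

/-- The conjugate flip `σ τ σ` (`B ↦ B⁻¹`), acting on the skeleton as `(a,b) ↦ (a,−b)`. [cite: CheegerKleinerNaor2011, §1.1] -/
def hzFlip1Iso : heisenbergZGraph ≃g heisenbergZGraph := hzSwapIso.trans (hzFlipIso.trans hzSwapIso)

/-- The sign part of the point group: flip the skeleton coordinates `i` with `ε i = −1`. [folklore] -/
def hzSignIso (ε : Fin 2 → ℤˣ) : heisenbergZGraph ≃g heisenbergZGraph :=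
  (if ε 0 = 1 then SimpleGraph.Iso.refl (G := heisenbergZGraph) else hzFlipIso).trans
    (if ε 1 = 1 then SimpleGraph.Iso.refl (G := heisenbergZGraph) else hzFlip1Iso)

/-- **The lifted point group**: for `g = (π, ε) : HOct 2`, first the swap (if `π ≠ 1`), then the sign flips.
[cite: CheegerKleinerNaor2011, §1.1] -/
def hzPointIso (g : HOct 2) : heisenbergZGraph ≃g heisenbergZGraph :=
  (if g.1 = 1 then SimpleGraph.Iso.refl (G := heisenbergZGraph) else hzSwapIso).trans (hzSignIso g.2)

/-- The sign isomorphisms fix `1`. [folklore] -/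
theorem hzSignIso_zero (ε : Fin 2 → ℤˣ) : hzSignIso ε 0 = 0 := by
  unfold hzSignIso hzFlip1Iso
  split_ifs <;> simp

/-- The point isomorphisms fix `1`. [folklore] -/
theorem hzPointIso_zero (g : HOct 2) : hzPointIso g 0 = 0 := by
  unfold hzPointIso
  split_ifs <;> simp [hzSignIso_zero]

/-- Action of the sign isomorphisms on the skeleton: coordinatewise signs. [folklore] -/
theorem hzAb_hzSignIso (ε : Fin 2 → ℤˣ) (w : HZ) (i : Fin 2) : hzAb (hzSignIso ε w) i = (ε i : ℤ) * hzAb w i := by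
  unfold hzSignIso hzFlip1Iso
  rcases Int.units_eq_one_or (ε 0) with h0 | h0 <;> rcases Int.units_eq_one_or (ε 1) with h1 | h1 <;>
    fin_cases i <;> simp [h0, h1, hzAb, hzSwap, hzFlip]

/-- **Equivariance of the lifted point group**: `hzAb ∘ hzPointIso g = sp g ∘ hzAb`. [cite: CheegerKleinerNaor2011, §1.1] -/
theorem hzAb_hzPointIso (g : HOct 2) (w : HZ) : hzAb (hzPointIso g w) = sp g (hzAb w) := by
  obtain ⟨π, ε⟩ := g
  ext i
  rw [Site.signedPerm_apply]
  have hperm : ∀ τ : Equiv.Perm (Fin 2), τ = 1 ∨ τ = Equiv.swap 0 1 := by decide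
  rcases hperm π with rfl | rfl
  · have h : hzPointIso (1, ε) w = hzSignIso ε w := by
      simp [hzPointIso]
    rw [h, hzAb_hzSignIso]
    rfl
  · have hne : (Equiv.swap (0 : Fin 2) 1) ≠ 1 := by decide
    have h : hzPointIso (Equiv.swap 0 1, ε) w = hzSignIso ε (hzSwap w) := by
      simp [hzPointIso, hne]
    rw [h, hzAb_hzSignIso]
    fin_cases i <;> simp [hzAb, hzSwap]

/-- `hzLeftIso g` acts by left multiplication. [folklore] -/
@[simp] theorem hzLeftIso_apply (g x : HZ) : hzLeftIso g x = hzMul g x := rfl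

/-! ## Amenability: growth `≤ (2n+1)⁵` -/

/-- Along a walk of length `k` from `u`: `a, b, t` move by at most `k` and `c` by at most `k (|a(u)| + k)`. [folklore] -/
theorem walk_coord_bounds {u y : HZ} (w : heisenbergZGraph.Walk u y) :
    |y 0 - u 0| ≤ w.length ∧ |y 1 - u 1| ≤ w.length ∧ |y 3 - u 3| ≤ w.length ∧
      |y 2 - u 2| ≤ w.length * (|u 0| + w.length) := by
  induction w with
  | nil => simp
  | @cons u v y hadj p ih =>
    obtain ⟨ih0, ih1, ih3, ih2⟩ := ih
    obtain ⟨s, hs, rfl⟩ := (hz_adj_iff u v).1 hadj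
    rw [mem_hzGens_iff] at hs
    simp only [SimpleGraph.Walk.length_cons, Nat.cast_add, Nat.cast_one]
    set m : ℤ := (p.length : ℤ) with hm
    have hm0 : 0 ≤ m := by positivity
    -- the one-step increments
    have h1 : ∀ a : ℤ, |a + 1| ≤ |a| + 1 := fun a => (abs_add_le a 1).trans (by simp)
    have h2 : ∀ a : ℤ, |a + -1| ≤ |a| + 1 := fun a => (abs_add_le a (-1)).trans (by simp)
    have hstep : |hzMul u s 0 - u 0| ≤ 1 ∧ |hzMul u s 1 - u 1| ≤ 1 ∧ |hzMul u s 3 - u 3| ≤ 1 ∧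
        |hzMul u s 2 - u 2| ≤ |u 0| ∧ |hzMul u s 0| ≤ |u 0| + 1 := by
      rcases hs with rfl | rfl | rfl | rfl | rfl | rfl
      · exact ⟨by simp [hzMul, gA], by simp [hzMul, gA], by simp [hzMul, gA], by simp [hzMul, gA],
          by simpa [hzMul, gA] using h1 (u 0)⟩
      · exact ⟨by simp [hzMul, gB], by simp [hzMul, gB], by simp [hzMul, gB], by simp [hzMul, gB], by simp [hzMul, gB]⟩
      · exact ⟨by simp [hzMul, gT], by simp [hzMul, gT], by simp [hzMul, gT], by simp [hzMul, gT], by simp [hzMul, gT]⟩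
      · exact ⟨by simp [hzMul, gAinv], by simp [hzMul, gAinv], by simp [hzMul, gAinv], by simp [hzMul, gAinv],
          by simpa [hzMul, gAinv] using h2 (u 0)⟩
      · exact ⟨by simp [hzMul, gBinv], by simp [hzMul, gBinv], by simp [hzMul, gBinv], by simp [hzMul, gBinv],
          by simp [hzMul, gBinv]⟩
      · exact ⟨by simp [hzMul, gTinv], by simp [hzMul, gTinv], by simp [hzMul, gTinv], by simp [hzMul, gTinv],
          by simp [hzMul, gTinv]⟩
    obtain ⟨s0, s1, s3, s2, sa⟩ := hstep
    refine ⟨?_, ?_, ?_, ?_⟩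
    · calc |y 0 - u 0| = |(y 0 - hzMul u s 0) + (hzMul u s 0 - u 0)| := by ring_nf
        _ ≤ |y 0 - hzMul u s 0| + |hzMul u s 0 - u 0| := abs_add_le _ _
        _ ≤ m + 1 := add_le_add ih0 s0
    · calc |y 1 - u 1| = |(y 1 - hzMul u s 1) + (hzMul u s 1 - u 1)| := by ring_nf
        _ ≤ |y 1 - hzMul u s 1| + |hzMul u s 1 - u 1| := abs_add_le _ _
        _ ≤ m + 1 := add_le_add ih1 s1
    · calc |y 3 - u 3| = |(y 3 - hzMul u s 3) + (hzMul u s 3 - u 3)| := by ring_nf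
        _ ≤ |y 3 - hzMul u s 3| + |hzMul u s 3 - u 3| := abs_add_le _ _
        _ ≤ m + 1 := add_le_add ih3 s3
    · have hA : 0 ≤ |u 0| := abs_nonneg _
      calc |y 2 - u 2| = |(y 2 - hzMul u s 2) + (hzMul u s 2 - u 2)| := by ring_nf
        _ ≤ |y 2 - hzMul u s 2| + |hzMul u s 2 - u 2| := abs_add_le _ _
        _ ≤ m * (|hzMul u s 0| + m) + |u 0| := add_le_add ih2 s2
        _ ≤ m * (|u 0| + 1 + m) + |u 0| := by gcongr
        _ ≤ (m + 1) * (|u 0| + (m + 1)) := by nlinarith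

/-- The coordinate box `{|a|,|b|,|t| ≤ n, |c| ≤ n²}` as a finite set. [folklore] -/
def hzBallBox (n : ℕ) : Finset HZ :=
  ((Finset.Icc (-(n : ℤ)) n ×ˢ Finset.Icc (-(n : ℤ)) n) ×ˢ (Finset.Icc (-((n : ℤ) * n)) (n * n) ×ˢ Finset.Icc (-(n : ℤ)) n)).image
    fun q => ![q.1.1, q.1.2, q.2.1, q.2.2]

/-- `|hzBallBox n| ≤ (2n+1)⁵`. [folklore] -/
theorem card_hzBallBox_le (n : ℕ) : (hzBallBox n).card ≤ (2 * n + 1) ^ 5 := by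
  refine Finset.card_image_le.trans ?_
  simp only [Finset.card_product, Int.card_Icc]
  have h1 : ((n : ℤ) + 1 - -(n : ℤ)).toNat = 2 * n + 1 := by omega
  have h2 : ((n : ℤ) * n + 1 - -((n : ℤ) * n)).toNat = 2 * (n * n) + 1 := by
    have : (n : ℤ) * n + 1 - -((n : ℤ) * n) = ((2 * (n * n) + 1 : ℕ) : ℤ) := by push_cast; ring
    rw [this, Int.toNat_natCast]
  rw [h1, h2]
  have h3 : 2 * (n * n) + 1 ≤ (2 * n + 1) ^ 2 := by nlinarith
  calc (2 * n + 1) * (2 * n + 1) * ((2 * (n * n) + 1) * (2 * n + 1))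
      ≤ (2 * n + 1) * (2 * n + 1) * ((2 * n + 1) ^ 2 * (2 * n + 1)) := by gcongr
    _ = (2 * n + 1) ^ 5 := by ring

/-- The graph ball of radius `n` about `1` lies in the coordinate box. [folklore] -/
theorem graphBall_heisenbergZ_subset (n : ℕ) : graphBall heisenbergZGraph (0 : HZ) n ⊆ ↑(hzBallBox n) := by
  rintro y ⟨w, hw⟩
  obtain ⟨h0, h1, h3, h2⟩ := walk_coord_bounds w
  simp only [Pi.zero_apply, sub_zero, abs_zero, zero_add] at h0 h1 h3 h2
  have hwn : (w.length : ℤ) ≤ n := by exact_mod_cast hw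
  have hl0 : (0 : ℤ) ≤ w.length := by positivity
  rw [Finset.mem_coe, hzBallBox, Finset.mem_image]
  refine ⟨((y 0, y 1), (y 2, y 3)), ?_, ?_⟩
  · simp only [Finset.mem_product, Finset.mem_Icc]
    rw [abs_le] at h0 h1 h3 h2
    refine ⟨⟨⟨?_, ?_⟩, ⟨?_, ?_⟩⟩, ⟨⟨?_, ?_⟩, ⟨?_, ?_⟩⟩⟩ <;> nlinarith
  · ext i; fin_cases i <;> rfl

/-- **Polynomial growth of degree `≤ 5`**: `|B(x,n)| ≤ (2n+1)⁵` for every vertex `x` (transported from `1` by `hzLeftIso x`).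
[cite: LyonsPeres2016, §6.1 (p. 279)] -/
theorem ballVolume_heisenbergZ_le (x : HZ) (n : ℕ) : ballVolume heisenbergZGraph x n ≤ (2 * n + 1) ^ 5 := by
  have hx : x = hzLeftIso x 0 := by rw [hzLeftIso_apply, hzMul_zero]
  rw [hx, ballVolume_map_eq, ballVolume]
  calc (graphBall heisenbergZGraph (0 : HZ) n).ncard ≤ (↑(hzBallBox n) : Set HZ).ncard :=
        Set.ncard_le_ncard (graphBall_heisenbergZ_subset n) (hzBallBox n).finite_toSet
    _ = (hzBallBox n).card := Set.ncard_coe_finset _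
    _ ≤ (2 * n + 1) ^ 5 := card_hzBallBox_le n

/-- **`Cay(H₃(ℤ) × ℤ)` does not have exponential growth.** [cite: Hutchcroft2016, Thm. 1 (the complementary class)] -/
theorem heisenbergZ_not_hasExponentialGrowth : ¬ HasExponentialGrowth heisenbergZGraph := by
  intro h
  obtain ⟨c, hc, hev⟩ := h 0
  obtain ⟨n, hn1, hn2⟩ := (hev.and (eventually_pow_lt_const_pow 5 hc)).exists
  have hvol : (ballVolume heisenbergZGraph (0 : HZ) n : ℝ) ≤ (2 * n + 1) ^ 5 := by
    exact_mod_cast ballVolume_heisenbergZ_le 0 n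
  linarith

/-- **`Cay(H₃(ℤ) × ℤ)` is amenable** (polynomial growth; Lyons–Peres §6.1 contrapositive). [cite: LyonsPeres2016, §6.1 (p. 279)] -/
theorem isGraphAmenable_heisenbergZ : IsGraphAmenable heisenbergZGraph := by
  by_contra h
  exact heisenbergZ_not_hasExponentialGrowth
    (hasExponentialGrowth_of_not_isGraphAmenable heisenbergZGraph heisenbergZGraph_quasiTransitive h)

end Summit.CriticalPhenomena.PercolationContinuityZ3.Theorems.Transplant

end
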